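import Summits.FinalStateConjecture.FinalStateConjecture.Theorems.SwallowTheDatumParametricKerrBurialStubTransportPatchB

/-!
# `ParametricKerrBurial`, line `receding-annulus-universal-collar` — helpers for the stub
# `stub_farGluing_of_unitGluing` (A2b) (crux item stmt-FinalStateConjecture-10052)

Plumbing for the far-gluing stub A2b ("insert the exterior solution at the end", Corvino 2000, §4),
all PROVED over the tree's patching files (`AFEndPatch.lean`, `AFEndAnnulusPatch.lean`,
`AFEndTransplant(Coeff).lean`, `InitialDataDilation.lean`):

* `isIsotropicBeyond_dilate` — the dilate by `l` of a datum on `ℝ³` which is exactly isotropic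
  Schwarzschild(`M`) beyond radius `ρ` is exactly isotropic Schwarzschild(`l M`) beyond `l ρ`;
* `farPatchData` — patch data `(coord^* h_C, coord^* k_C)` for a datum `D` on `X` with radii
  `(ρ₁, ρ₂)` from a datum `C` on `ℝ³` whose Cartesian components ARE the chart components of `D`
  on the shell `{ρ₁ < ‖y‖ < ρ₂}` (the variant of `AFEnd.annulusPatchData` with the agreement
  hypothesis stated directly);
* for ANY patch data of that shape: the chart reading of the patch beyond `ρ₁` is `C`
  (`hCoeff_patch_eq`), its restriction to the far region is the pullback of `C` along `coord`
  (`patch_comap_val_eq`), it is vacuum when `D` is and `C` is vacuum on `{ρ₁ < ‖y‖}`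
  (`isVacuumConstraintSolution_patch_of_vacuumOn`, locality and naturality of the constraint map),
  it has the Dafermos–Rodnianski decay of `C` along the transplanted (`λ = 1`) end of `C`
  (`isStronglyAsymptoticallyFlatDR_patch`), and it is admissible when moreover `e` is the sole end
  of `X` and `C` has a sole Dafermos–Rodnianski end (`patch_mem_admissibleVacuumData_of_vacuumOn`);
* `contMDiffOn_rescaledFamily` — joint smoothness of the Cartesian components
  `(R, z) ↦ h_{O R}(z/R)`, `(R, z) ↦ R⁻¹ k_{O R}(z/R)` of the dilates of a family `O R` of data on
  `ℝ³` with sections jointly smooth on `{R⋆ < R} × {1 < ‖y‖}`, on `{R⋆ < R} × {R < ‖z‖}`.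

References: Corvino 2000, §4; Bartnik 1986, §1; Bartnik–Isenberg 2004, §2; Dafermos–Rodnianski
2013, App. B.2.3; Christodoulou 1999, p. A24.
-/

-- the doubled `FinalStateConjecture` path component is the summit/problem naming scheme, not a mistake
set_option linter.dupNamespace false
-- instance search through the nested operator type `E3 →L[ℝ] E3 →L[ℝ] ℝ` (as in the tree files)
set_option maxSynthPendingDepth 3

noncomputable section

namespace Summit.FinalStateConjecture.FinalStateConjecture.Theorems.SwallowTheDatum.ParametricKerrBurial

open scoped Manifold ContDiff Topology
-- NB: no `open Bundle` (instance synthesis time-outs downstream); `Bundle.TotalSpace.mk'` is qualified.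
open Set Filter Function Metric Literature.Geometry.Lorentzian Literature.Geometry.Manifold

variable {X : Type} [TopologicalSpace X] [ChartedSpace E3 X] [IsManifold (𝓡 3) ∞ X]

/-! ## §1 Dilation covariance of the exact isotropic end -/

/-- **The dilate of an exactly isotropic Schwarzschild end is an exactly isotropic Schwarzschild
end**: `h_l(y) = h(y/l) = (1 + M/(2‖y/l‖))⁴ δ = (1 + lM/(2‖y‖))⁴ δ` and `k_l(y) = l⁻¹ k(y/l) = 0`
for `‖y‖ > l ρ`. Misner–Thorne–Wheeler 1973, (31.22); Bartnik–Isenberg 2004, §2.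
[cite: BartnikIsenberg2004, §2] -/
theorem isIsotropicBeyond_dilate (C : InitialDataSet (𝓡 3) E3) {M ρ : ℝ}
    (hC : IsIsotropicBeyond M ρ C) {l : ℝ} (hl : 0 < l) (hρ : 0 < ρ) :
    IsIsotropicBeyond (l * M) (l * ρ) (C.dilate l hl) := by
  intro y hy
  have hnorm : ‖l⁻¹ • y‖ = l⁻¹ * ‖y‖ := by
    rw [norm_smul, Real.norm_eq_abs, abs_of_pos (inv_pos.2 hl)]
  have hy0 : y ≠ 0 := by
    rintro rfl; rw [norm_zero] at hy; linarith [mul_pos hl hρ]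
  have hy' : ρ < ‖l⁻¹ • y‖ := by
    rw [hnorm, lt_inv_mul_iff₀ hl]; exact hy
  have hfrac : M / (2 * ‖l⁻¹ • y‖) = l * M / (2 * ‖y‖) := by
    have hy'' : ‖y‖ ≠ 0 := norm_ne_zero_iff.2 hy0
    rw [hnorm]
    field_simp
  have hhE : ((C.dilate l hl).h.inner y : E3 →L[ℝ] E3 →L[ℝ] ℝ) = C.h.inner (l⁻¹ • y) := by
    ext v w; exact C.dilate_h_inner l hl y v w
  have hkE : ((C.dilate l hl).k y : E3 →L[ℝ] E3 →L[ℝ] ℝ) = l⁻¹ • C.k (l⁻¹ • y) := by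
    ext v w; exact C.dilate_k l hl y v w
  obtain ⟨h1, h2⟩ := hC (l⁻¹ • y) hy'
  refine ⟨?_, ?_⟩
  · rw [hhE, h1, hfrac]
    rfl
  · rw [hkE, h2, smul_zero]
    rfl

/-! ## §2 Patching a datum on `X` with a datum on `ℝ³` read through the chart of the end -/

section FarPatch

variable {e : AFEnd X} {D : InitialDataSet (𝓡 3) X} {C : InitialDataSet (𝓡 3) E3} {ρ₁ ρ₂ : ℝ}

/-- **Patch data from a datum on `ℝ³` reading `D` on a shell**: if the Cartesian components of
`C` are the chart components of `D` on `{ρ₁ < ‖y‖ < ρ₂}` (`R ≤ ρ₁ < ρ₂`), the outer fields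
`(coord^* h_C, coord^* k_C)` patch `D` with radii `(ρ₁, ρ₂)`. [cite: Corvino2000, §4] -/
theorem farPatchData (hR : e.R ≤ ρ₁) (hlt : ρ₁ < ρ₂)
    (hagree : ∀ y : E3, ρ₁ < ‖y‖ → ‖y‖ < ρ₂ →
      C.coordH y = AFEnd.hCoeff e D y ∧ C.coordK y = AFEnd.kCoeff e D y) :
    e.PatchData D ρ₁ ρ₂ (AFEnd.outerField e C.coordH) (AFEnd.outerField e C.coordK) where
  R_le := hR
  lt := hlt
  smooth_h := e.smoothBilinOn_outerField C.contMDiff_coordH.contDiff (e.far_subset _)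
  smooth_k := e.smoothBilinOn_outerField C.contMDiff_coordK.contDiff (e.far_subset _)
  symm_h x _ v w := e.outerField_symm (fun z v w ↦ C.h.symm z v w) x v w
  pos_h x hx v hv := e.outerField_pos (fun z v hv ↦ C.h.pos z v hv) (e.far_subset _ hx) v hv
  symm_k x _ v w := e.outerField_symm (fun z v w ↦ C.k_symm z v w) x v w
  agree_h x hx hlt' := by
    obtain ⟨hxU, hgt⟩ := e.mem_far_iff_coord.1 hx
    exact e.outerField_eq_h_inner D hxU (hagree _ hgt hlt').1
  agree_k x hx hlt' := by
    obtain ⟨hxU, hgt⟩ := e.mem_far_iff_coord.1 hx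
    exact e.outerField_eq_k D hxU (hagree _ hgt hlt').2

variable (P : e.PatchData D ρ₁ ρ₂ (AFEnd.outerField e C.coordH) (AFEnd.outerField e C.coordK))

include P in
/-- **The chart reading of the patch beyond `ρ₁` is `C`**: `hCoeff e (D ⋈ C) z = h_C(z)` and
`kCoeff e (D ⋈ C) z = k_C(z)` for `‖z‖ > ρ₁` (`Φₑ^*(coord^* H) = H` beyond the chart radius).
[cite: Bartnik1986, (1.3)] -/
theorem hCoeff_patch_eq {z : E3} (hz : ρ₁ < ‖z‖) :
    AFEnd.hCoeff e (e.patch D P) z = C.coordH z ∧ AFEnd.kCoeff e (e.patch D P) z = C.coordK z := by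
  have hzR : e.R < ‖z‖ := lt_of_le_of_lt P.R_le hz
  have hx : e.dataChartExt z ∈ e.far ρ₁ := (e.dataChartExt_mem_far_iff hzR).2 hz
  refine ⟨?_, ?_⟩
  · ext v w
    rw [e.hCoeff_apply_eq_dataChartExt _ hzR, AFEnd.patch_h_inner_of_mem P hx,
      AFEnd.outerField_apply, e.mfderiv_coord_mfderiv_dataChartExt hzR,
      e.mfderiv_coord_mfderiv_dataChartExt hzR, e.coord_dataChartExt_of_lt hzR]
  · ext v w
    rw [e.kCoeff_apply_eq_dataChartExt _ hzR, AFEnd.patch_k_of_mem P hx,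
      AFEnd.outerField_apply, e.mfderiv_coord_mfderiv_dataChartExt hzR,
      e.mfderiv_coord_mfderiv_dataChartExt hzR, e.coord_dataChartExt_of_lt hzR]

/-- **On the far region, the restriction of the patch IS the pullback of `C` along `coord`.**
[cite: BartnikIsenberg2004, §2] -/
theorem patch_comap_val_eq :
    (e.patch D P).comap (Subtype.val : e.farOpens ρ₁ → X)
        (InitialDataSet.contMDiff_subtypeVal_succ _) (InitialDataSet.injective_mfderiv_subtypeVal _) =
      C.comap (e.coord ∘ (Subtype.val : e.farOpens ρ₁ → X)) (AFEnd.contMDiff_coord_comp_val ρ₁)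
        (AFEnd.injective_mfderiv_coord_comp_val ρ₁) := by
  have hchain : ∀ (u : e.farOpens ρ₁) (v : TangentSpace (𝓡 3) u),
      mfderiv (𝓡 3) 𝓘(ℝ, E3) (e.coord ∘ (Subtype.val : e.farOpens ρ₁ → X)) u v =
        mfderiv (𝓡 3) 𝓘(ℝ, E3) e.coord (u : X)
          (mfderiv (𝓡 3) (𝓡 3) (Subtype.val : e.farOpens ρ₁ → X) u v) := by
    intro u v
    have hc : MDifferentiableAt (𝓡 3) 𝓘(ℝ, E3) e.coord (u : X) :=
      (e.contMDiffAt_coord (e.far_subset _ u.2)).mdifferentiableAt (by simp)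
    have hv : MDifferentiableAt (𝓡 3) (𝓡 3) (Subtype.val : e.farOpens ρ₁ → X) u :=
      (contMDiff_subtype_val (n := ∞)).mdifferentiableAt (by simp)
    rw [mfderiv_comp u hc hv]
    rfl
  refine InitialDataSet.ext' (fun u v w ↦ ?_) (fun u v w ↦ ?_)
  · rw [InitialDataSet.comap_h_inner, InitialDataSet.comap_h_inner,
      AFEnd.patch_h_inner_of_mem P u.2, AFEnd.outerField_apply, hchain, hchain]
    rfl
  · rw [InitialDataSet.comap_k, InitialDataSet.comap_k, AFEnd.patch_k_of_mem P u.2,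
      AFEnd.outerField_apply, hchain, hchain]
    rfl

/-- **The patch of vacuum data by a datum on `ℝ³` which is vacuum on `{ρ₁ < ‖y‖}` is vacuum**:
off the far region the patch is locally `D`; on it, its restriction is the pullback of `C` along
`coord`, whose values there have norm `> ρ₁`, and the vacuum constraints are natural pointwise
under local diffeomorphisms. [cite: BartnikIsenberg2004, §2] -/
theorem isVacuumConstraintSolution_patch_of_vacuumOn [(e.patch D P).metric.HasLeviCivita]
    (hD : ∀ [D.metric.HasLeviCivita], D.IsVacuumConstraintSolution)
    (hC : VacuumOn {y | ρ₁ < ‖y‖} C) : (e.patch D P).IsVacuumConstraintSolution := by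
  haveI : D.metric.HasLeviCivita := D.metric.hasLeviCivita
  haveI : C.metric.HasLeviCivita := C.metric.hasLeviCivita
  intro x
  by_cases hx : x ∈ e.far ρ₁
  · -- on the far region: restriction = pullback of `C`, evaluated at `coord x`, `‖coord x‖ > ρ₁`
    set V : TopologicalSpace.Opens X := e.farOpens ρ₁ with hV
    haveI h1 : ((e.patch D P).comap (Subtype.val : V → X)
        (InitialDataSet.contMDiff_subtypeVal_succ V)
        (InitialDataSet.injective_mfderiv_subtypeVal V)).metric.HasLeviCivita :=
      PseudoRiemannianMetric.hasLeviCivita _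
    haveI h2 : (C.comap (e.coord ∘ (Subtype.val : V → X)) (AFEnd.contMDiff_coord_comp_val ρ₁)
        (AFEnd.injective_mfderiv_coord_comp_val ρ₁)).metric.HasLeviCivita :=
      PseudoRiemannianMetric.hasLeviCivita _
    have hu := (InitialDataSet.isVacuumAt_comap_iff (e.patch D P)
      (InitialDataSet.contMDiff_subtypeVal_succ V) (InitialDataSet.injective_mfderiv_subtypeVal V)
      ⟨x, hx⟩).1
    apply hu
    obtain ⟨-, hgt⟩ := e.mem_far_iff_coord.1 hx
    have hCx : C.hamiltonianConstraintFn (e.coord x) = 0 ∧ C.momentumConstraintFn (e.coord x) = 0 :=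
      hC (e.coord x) hgt
    have hcomap := (InitialDataSet.isVacuumAt_comap_iff C (AFEnd.contMDiff_coord_comp_val ρ₁)
      (AFEnd.injective_mfderiv_coord_comp_val ρ₁) (⟨x, hx⟩ : V)).2 hCx
    have key : ∀ (A' B' : InitialDataSet (𝓡 3) V) [A'.metric.HasLeviCivita] [B'.metric.HasLeviCivita],
        A' = B' → (B'.hamiltonianConstraintFn ⟨x, hx⟩ = 0 ∧ B'.momentumConstraintFn ⟨x, hx⟩ = 0) →
          (A'.hamiltonianConstraintFn ⟨x, hx⟩ = 0 ∧ A'.momentumConstraintFn ⟨x, hx⟩ = 0) := by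
      rintro A' B' _ _ rfl hB
      exact hB
    exact key _ _ (patch_comap_val_eq P) hcomap
  · -- off the far region: locally `D`
    obtain ⟨hh, hk⟩ := AFEnd.patch_eventuallyEq_of_not_mem_far P hx
    exact (InitialDataSet.isVacuumAt_congr hh hk).2 (hD x)

include P in
/-- **Transplant data for an end `f` of `ℝ³`**: radii `ρ₁' ≥ f.R`, `ρ₀ > ρ₁` with
`f.far ρ₁' ⊆ {ρ₀ ≤ ‖y‖}` (far regions eventually avoid the compact ball), so that
`TransplantData e f 1 ρ₀ ρ₁'`. [cite: Bartnik1986, §1] -/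
theorem exists_transplantData_patch (f : AFEnd E3) :
    ∃ ρ₀ ρ₁' : ℝ, ρ₁ < ρ₀ ∧ AFEnd.TransplantData e f 1 ρ₀ ρ₁' := by
  obtain ⟨R₀, hR₀⟩ := f.exists_forall_far_disjoint (isCompact_closedBall (0 : E3) (ρ₁ + 1))
  refine ⟨ρ₁ + 1, max R₀ f.R, by linarith, one_pos, le_max_right _ _, ?_, fun y hy ↦ ?_⟩
  · rw [one_mul]; linarith [P.R_le]
  · by_contra h
    rw [not_le] at h
    have hmem : y ∈ closedBall (0 : E3) (ρ₁ + 1) := by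
      rw [mem_closedBall, dist_zero_right]; exact h.le
    exact Set.disjoint_left.1 (hR₀ _ (le_max_left _ _)) hy hmem

/-- **The patch is strongly asymptotically flat along the transplanted end of `C`**, with the mass
of `C` (its sections on the transplanted region are the pullbacks of those of `C` along
`Ψ₁ = coord`). [cite: DafermosRodnianski2013, App. B.2.3] -/
theorem isStronglyAsymptoticallyFlatDR_patch {f : AFEnd E3} {ρ₀ ρ₁' : ℝ} (hρ₀ : ρ₁ < ρ₀)
    (T : AFEnd.TransplantData e f 1 ρ₀ ρ₁') {M₁ : ℝ} (hC : f.IsStronglyAsymptoticallyFlatDR C M₁) :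
    (AFEnd.transplant T).IsStronglyAsymptoticallyFlatDR (e.patch D P) M₁ := by
  have hfar : ∀ x ∈ (AFEnd.transplant T).U, x ∈ e.far ρ₁ := by
    intro x hx
    obtain ⟨hxU, hΨ⟩ := (AFEnd.mem_transplant_U T).1 hx
    have hn : ρ₀ ≤ ‖e.coord x‖ := by
      have h := T.le_norm _ hΨ
      rwa [AFEnd.transplantMap_one] at h
    exact e.mem_far_iff_coord.2 ⟨hxU, lt_of_lt_of_le hρ₀ hn⟩
  have hSh : ∀ x ∈ (AFEnd.transplant T).U, (e.patch D P).h.inner x =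
      (1 : ℝ) ^ 2 • pullbackBilin (I := 𝓘(ℝ, E3)) (I' := 𝓡 3) (e.transplantMap 1)
        (show Π y : E3, TangentSpace 𝓘(ℝ, E3) y →L[ℝ] TangentSpace 𝓘(ℝ, E3) y →L[ℝ] ℝ from
          C.h.inner) x := by
    intro x hx
    rw [one_pow, one_smul, AFEnd.transplantMap_one, AFEnd.patch_h_inner_of_mem P (hfar x hx)]
    rfl
  have hSk : ∀ x ∈ (AFEnd.transplant T).U, (e.patch D P).k x =
      (1 : ℝ) • pullbackBilin (I := 𝓘(ℝ, E3)) (I' := 𝓡 3) (e.transplantMap 1)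
        (show Π y : E3, TangentSpace 𝓘(ℝ, E3) y →L[ℝ] TangentSpace 𝓘(ℝ, E3) y →L[ℝ] ℝ from C.k) x := by
    intro x hx
    rw [one_smul, AFEnd.transplantMap_one, AFEnd.patch_k_of_mem P (hfar x hx)]
    rfl
  have h := AFEnd.IsStronglyAsymptoticallyFlatDR.transplant T C (e.patch D P) hSh hSk hC
  rwa [one_mul] at h

variable [T2Space X] [SecondCountableTopology X] [ConnectedSpace X]

/-- **The patch of vacuum data with a sole end by a datum on `ℝ³` which is vacuum on `{ρ₁ < ‖y‖}`
and has a sole Dafermos–Rodnianski end is admissible**: vacuum by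
`isVacuumConstraintSolution_patch_of_vacuumOn`; its end is the transplanted end of `C` (sole,
`isSoleEnd_transplant`; decay, `isStronglyAsymptoticallyFlatDR_patch`); complete because
one-ended asymptotically flat data are (`isComplete_of_isSoleEnd_holds`). Christodoulou 1999,
p. A24 (the admissible class). [cite: Christodoulou1999, p. A24] -/
theorem patch_mem_admissibleVacuumData_of_vacuumOn (he : e.IsSoleEnd)
    (hD : ∀ [D.metric.HasLeviCivita], D.IsVacuumConstraintSolution)
    (hCvac : VacuumOn {y | ρ₁ < ‖y‖} C) {f : AFEnd E3} {M₁ : ℝ} (hfsole : f.IsSoleEnd)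
    (hfdecay : f.IsStronglyAsymptoticallyFlatDR C M₁) :
    e.patch D P ∈ admissibleVacuumData X := by
  obtain ⟨ρ₀, ρ₁', hρ₀, T⟩ := exists_transplantData_patch P f
  have hdecay := isStronglyAsymptoticallyFlatDR_patch P hρ₀ T hfdecay
  have hsole : (AFEnd.transplant T).IsSoleEnd :=
    AFEnd.isSoleEnd_transplant T he (AFEnd.exists_forall_mem_far_of_isSoleEnd hfsole)
  refine ⟨?_, AFEnd.transplant T, M₁, hsole, hdecay⟩
  intro inst
  exact ⟨isVacuumConstraintSolution_patch_of_vacuumOn P hD hCvac,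
    isComplete_of_isSoleEnd_holds X (e.patch D P) (AFEnd.transplant T) M₁ 1 2 2 1
      zero_le_one hdecay hsole⟩

end FarPatch

/-! ## §3 The Cartesian components of the dilates of a smooth family on `ℝ³` -/

/-- The two section maps of a family of data on `ℝ³` with sections jointly smooth on an open set
`s`, as plain smooth matrix-valued functions on `s` (bundle smoothness over the model space is
plain smoothness, `contMDiffOn_bilinSection_model_iff`). [folklore] -/
theorem contMDiffOn_coord_of_smoothSectionsOn {O : ℝ → InitialDataSet (𝓡 3) E3} {s : Set (ℝ × E3)}
    (hs : IsOpen s) (hO : SmoothSectionsOn 𝓘(ℝ, ℝ) O s) :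
    ContMDiffOn (𝓘(ℝ, ℝ).prod 𝓘(ℝ, E3)) 𝓘(ℝ, E3 →L[ℝ] E3 →L[ℝ] ℝ) ∞
        (fun p : ℝ × E3 ↦ (O p.1).coordH p.2) s ∧
      ContMDiffOn (𝓘(ℝ, ℝ).prod 𝓘(ℝ, E3)) 𝓘(ℝ, E3 →L[ℝ] E3 →L[ℝ] ℝ) ∞
        (fun p : ℝ × E3 ↦ (O p.1).coordK p.2) s :=
  ⟨((contMDiffOn_bilinSection_model_iff (IQ := 𝓘(ℝ, ℝ).prod 𝓘(ℝ, E3)) (b := fun p : ℝ × E3 ↦ p.2)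
      (s := fun p : ℝ × E3 ↦ (O p.1).coordH p.2) hs).1 hO.1).2,
    ((contMDiffOn_bilinSection_model_iff (IQ := 𝓘(ℝ, ℝ).prod 𝓘(ℝ, E3)) (b := fun p : ℝ × E3 ↦ p.2)
      (s := fun p : ℝ × E3 ↦ (O p.1).coordK p.2) hs).1 hO.2).2⟩

/-- **Joint smoothness of the Cartesian components of the dilates** `(O R).dilate R` of a family
of data on `ℝ³` with sections jointly smooth on `{R⋆ < R} × {1 < ‖y‖}` (`R⋆ ≥ 1`): the maps
`(R, z) ↦ h_{O R}(z/R)` and `(R, z) ↦ R⁻¹ k_{O R}(z/R)` are smooth on `{R⋆ < R} × {R < ‖z‖}`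
(composition with the smooth `(R, z) ↦ (R, z/R)`). [folklore] -/
theorem contMDiffOn_rescaledFamily {O : ℝ → InitialDataSet (𝓡 3) E3} {Rstar : ℝ} (h1 : 1 ≤ Rstar)
    (hO : SmoothSectionsOn 𝓘(ℝ, ℝ) O {p : ℝ × E3 | Rstar < p.1 ∧ 1 < ‖p.2‖}) :
    ContMDiffOn (𝓘(ℝ, ℝ).prod 𝓘(ℝ, E3)) 𝓘(ℝ, E3 →L[ℝ] E3 →L[ℝ] ℝ) ∞
        (fun p : ℝ × E3 ↦ (O p.1).coordH (p.1⁻¹ • p.2)) {p : ℝ × E3 | Rstar < p.1 ∧ p.1 < ‖p.2‖} ∧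
      ContMDiffOn (𝓘(ℝ, ℝ).prod 𝓘(ℝ, E3)) 𝓘(ℝ, E3 →L[ℝ] E3 →L[ℝ] ℝ) ∞
        (fun p : ℝ × E3 ↦ p.1⁻¹ • (O p.1).coordK (p.1⁻¹ • p.2))
        {p : ℝ × E3 | Rstar < p.1 ∧ p.1 < ‖p.2‖} := by
  have hopen : IsOpen {p : ℝ × E3 | Rstar < p.1 ∧ 1 < ‖p.2‖} :=
    (isOpen_lt continuous_const continuous_fst).inter
      (isOpen_lt continuous_const (continuous_norm.comp continuous_snd))
  obtain ⟨hH, hK⟩ := contMDiffOn_coord_of_smoothSectionsOn hopen hO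
  have hpos : ∀ p ∈ {p : ℝ × E3 | Rstar < p.1 ∧ p.1 < ‖p.2‖}, 0 < p.1 := fun p hp ↦ by
    linarith [hp.1]
  have hφ : ContMDiffOn (𝓘(ℝ, ℝ).prod 𝓘(ℝ, E3)) (𝓘(ℝ, ℝ).prod 𝓘(ℝ, E3)) ∞
      (fun p : ℝ × E3 ↦ (p.1, p.1⁻¹ • p.2)) {p : ℝ × E3 | Rstar < p.1 ∧ p.1 < ‖p.2‖} := fun p hp ↦
    (contMDiffAt_fst.prodMk (InitialDataSet.contMDiffAt_shrink_uncurry (hpos p hp).ne')).contMDiffWithinAt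
  have hmaps : MapsTo (fun p : ℝ × E3 ↦ (p.1, p.1⁻¹ • p.2)) {p : ℝ × E3 | Rstar < p.1 ∧ p.1 < ‖p.2‖}
      {p : ℝ × E3 | Rstar < p.1 ∧ 1 < ‖p.2‖} := by
    intro p hp
    refine ⟨hp.1, ?_⟩
    show 1 < ‖p.1⁻¹ • p.2‖
    rw [norm_smul, norm_inv, Real.norm_of_nonneg (hpos p hp).le, lt_inv_mul_iff₀ (hpos p hp),
      mul_one]
    exact hp.2
  have hinv : ContMDiffOn (𝓘(ℝ, ℝ).prod 𝓘(ℝ, E3)) 𝓘(ℝ, ℝ) ∞ (fun p : ℝ × E3 ↦ p.1⁻¹)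
      {p : ℝ × E3 | Rstar < p.1 ∧ p.1 < ‖p.2‖} := fun p hp ↦
    (InitialDataSet.contMDiffAt_inv_fst (hpos p hp).ne').contMDiffWithinAt
  exact ⟨hH.comp hφ hmaps, hinv.smul (hK.comp hφ hmaps)⟩

/-! ## §4 The registered sub-goal -/

/-- **Registered sub-goal `farPatch_mem_admissibleVacuumData`** (crux item stmt-FinalStateConjecture-10052,
helper of the stub `stub_farGluing_of_unitGluing`): the patch of a vacuum datum `D` on `X` (sole end
`e`) by a datum `C` on `ℝ³` read through the chart of the end — `D` off `e.far ρ₁`, `coord^* C`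
on it — is admissible as soon as `C` is vacuum on `{ρ₁ < ‖y‖}` and has a sole Dafermos–Rodnianski
end (`patch_mem_admissibleVacuumData_of_vacuumOn`, closed form). Corvino 2000, §4; Christodoulou
1999, p. A24. [folklore] -/
theorem farPatch_mem_admissibleVacuumData :
    ∀ (X : Type) [TopologicalSpace X] [ChartedSpace E3 X] [IsManifold (𝓡 3) ∞ X] [T2Space X]
      [SecondCountableTopology X] [ConnectedSpace X] (e : AFEnd X) (D : InitialDataSet (𝓡 3) X)
      (C : InitialDataSet (𝓡 3) E3) (ρ₁ ρ₂ : ℝ)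
      (P : e.PatchData D ρ₁ ρ₂ (AFEnd.outerField e C.coordH) (AFEnd.outerField e C.coordK))
      (f : AFEnd E3) (M₁ : ℝ),
      e.IsSoleEnd → (∀ [D.metric.HasLeviCivita], D.IsVacuumConstraintSolution) →
      VacuumOn {y | ρ₁ < ‖y‖} C → f.IsSoleEnd → f.IsStronglyAsymptoticallyFlatDR C M₁ →
      e.patch D P ∈ admissibleVacuumData X :=
  fun _ _ _ _ _ _ _ _ _ _ _ _ P _ _ he hD hC hfsole hfdecay ↦
    patch_mem_admissibleVacuumData_of_vacuumOn P he hD hC hfsole hfdecay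

end Summit.FinalStateConjecture.FinalStateConjecture.Theorems.SwallowTheDatum.ParametricKerrBurial

end
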